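import Literature.NumberTheory.EllipticCurves.ModularCurve
import Literature.NumberTheory.EllipticCurves.QuadraticTwist
import Literature.NumberTheory.EllipticCurves.Isogeny
import Literature.NumberTheory.EllipticCurves.GlobalMinimalModel
import Literature.NumberTheory.DiophantineGeometry.Conductor
import HarnessLib
import HarnessLib.Audit.Tags

/-!
# Candidate E-imc-1b (v2): the oriented EXACT `+1` law for optimal modular degrees under a ramified twist,
# `E[p]` irreducible (`RamifiedTwistDegreeLaw p`)
# — cell `bsd-f2-manin` (D-0131 (3) frontier: the Manin constant at additive primes). `@[conjecture]`
# leaf (NOTHING asserted; definitions only; proved edges in `RamifiedTwistEdges.lean`).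

HONEST FRAMING. LENS = Iwasawa-main-conjecture / Λ-adic integrality read as RAMIFIED-QUADRATIC-TWIST
laws at the additive prime (planner-of-record `bsd-f2-manin-imc`, HOME
`run/shared/lean/pub/bsd-f2-manin/MEMO-imc.md` §§1–5 (sha16 7c7fd3ff00b6a3f6), Props VERBATIM from
HOME/imc/Sketch-imc.lean (namespace `BsdF2ManinImc`, farm rc 0) with its two abbreviations inlined:
`pStar p = (((-1)^(p/2) · p : ℤ) : ℚ)` (`p* = (−1)^{(p−1)/2} p` for odd `p`, the spelling of the tree's
`ModularParametrizationData.deg_mul_sq_mul_sq_eq_of_quadraticTwist_pStar`) and `IsLatticeOptimal D`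
= the lattice clause `Λ_W = c·Λ_f`. «Ramified twist pair at `p`»: `W`, `W′` globally minimal models
of the `X₀(N)`-optimal curves of a class `𝒜` and of `𝒜 ⊗ χ_{p*}` (data `D`, `D′` at the CONDUCTOR
levels with the lattice clauses — refuter-1 traps T1/T2/T3 on BOTH curves), both additive at `p`
(`p² ∣ N`), SAME conductor (automatic for `p ≥ 5` potentially good; a restriction at `p = 3`),
`W′ ~ W ⊗ χ_{p*}`. Lens dictionary and why this is the IMC reading: memo §1 (no Hida family through
an `a_p = 0` newform; the family is the twist orbit, `R_ψ` plays `U_p`, the «divisibility» is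
Edixhoven's index law `[s⁻¹Λ_f : Λ_{f⊗ψ}] ∈ {1, p}`). NOT in print (memo §7; refuter-2 pre-placement
B4/B5): printed twist transports of the Manin `p`-part need the partner SEMISTABLE at `p` (Stevens
1989 §5; tree `ManinConstantQuadraticTwist*`) or settle only the potentially supersingular case
(Edixhoven 1991 §4); Watkins 2002 §2.1 / Delaunay 2003 give the degree identity «if we assume the
Manin constants are the same» (tree PROVED `…deg_mul_sq_mul_sq_eq_of_quadraticTwist_pStar`:
`D′.deg·D.c²·u² = p·D.deg·D′.c²`, silent on optimality and on `ord_p c`). Data: memo §5 and the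
in-seat PAIRWISE TWIST CENSUS v0 (HOME/imc/TWISTCENSUS-v0-N1e5-*, N < 10⁵, 578 278 rows) which
KILLED the v1 forms of IMC-D / IMC-A without `E[p]` irreducible (HOME/CANDIDATES.md §F F-imc-1/3:
50a1 ⊗ χ₅ ≅ 50b3, 5-isogenous to the optimal 50b1). Refuter verdicts: v1 (without `E[p]` irreducible) REF1 **KILLED
(refuted-misstated)**; this v2 row REF1 **SURVIVES** 2026-08-27T14:02Z (HOME/REFUTER-ref1.md §R1.3:
v2 misses all 6 312 flip witnesses; 0 violations among irreducible pairs N < 10⁵; BC7 CLEAN); REF2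
pending at filing.

THIS ROW (E-imc-1b = v2 of IMC-D, memo §3; v1 WITHOUT `E[p]` irreducible is FALSE — HOME/CANDIDATES.md
§F F-imc-1: 50a1/50b1 at `p = 5`): for a ramified twist pair of optimal curves at the odd prime `p`
with `E[p]` IRREDUCIBLE (`W.HasIrreducibleModPGaloisRep p`: no rational `p`-isogeny), classes distinct
(non-CM), oriented by `v_p(Δ_min(W)) < 6` (the `u = 1` side: the naive twisted model of `W` stays
minimal at `p`): `v_p(deg φ₀(𝒜 ⊗ χ_{p*})) = v_p(deg φ₀(𝒜)) + 1` EXACTLY. BC5 WITNESS (memo §5): `p = 3`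
necessary shadow on table 6845c1f1d5e22f91 — every STARRED optimal curve at `3` (`9 ∣ N`, class ≠ 27a)
has `3 ∣ deg φ₀`: meets 111 060 / beyond-print 111 060 / violations 0; histogram `v₃(N) = 3`:
#IV-classes at `v₃(deg φ₀) = k` = #II*-classes at `k+1` in every bin (26 736/26 737); census v0
(N < 10⁵, p ≥ 5): all violations of v1 are rational-`p`-isogeny («flip») rows, 0 on the irreducible side.
-/

noncomputable section

open scoped MatrixGroups ModularForm

open CongruenceSubgroup WeierstrassCurve
  Literature.NumberTheory.EllipticCurves Literature.NumberTheory.EllipticCurves.ModularForms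

namespace Summit.BirchSwinnertonDyer.Rank1Residual.ManinAdditive

/-- **Candidate E-imc-1b `RamifiedTwistDegreeLaw p` (v2; cell bsd-f2-manin; a LAW, NOT in print,
nothing asserted):** same pair as `RamifiedTwistManinInvariance`, with `W.HasIrreducibleModPGaloisRep p`,
the twisted class different from the class of `W`, and `W` on the `u = 1` side
(`v_p(Δ_min(W)) < 6`): `v_p(D′.deg) = v_p(D.deg) + 1`.
[cite: Watkins2002, §2.1 p. 491 (shape only: the degree identity under twists; the oriented exact +1 law for OPTIMAL degrees is NOT in print — cell bsd-f2-manin MEMO-imc.md §3 IMC-D v2)] -/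
@[conjecture] def RamifiedTwistDegreeLaw (p : ℕ) : Prop :=
  ∀ (W W' : WeierstrassCurve ℚ) [W.IsElliptic] [W.IsGloballyMinimal] [W'.IsElliptic]
    [W'.IsGloballyMinimal] [NeZero (W.conductorNorm ℤ)] [NeZero (W'.conductorNorm ℤ)]
    (D : ModularParametrizationData W (W.conductorNorm ℤ))
    (D' : ModularParametrizationData W' (W'.conductorNorm ℤ)),
    p.Prime → p ≠ 2 →
    (∀ z ∈ D.L.lattice, ∃ w ∈ periodLattice D.f, z = D.c * w) →
    (∀ z ∈ D'.L.lattice, ∃ w ∈ periodLattice D'.f, z = D'.c * w) →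
    p ^ 2 ∣ W.conductorNorm ℤ → W'.conductorNorm ℤ = W.conductorNorm ℤ →
    IsIsogenous (W.quadraticTwist ((((-1 : ℤ) ^ (p / 2) * p : ℤ) : ℚ))) W' →
    W.HasIrreducibleModPGaloisRep p →
    ¬ IsIsogenous W W' →
    padicValInt p W.minimalDiscriminantInt < 6 →
    padicValNat p D'.modularDegree = padicValNat p D.modularDegree + 1

end Summit.BirchSwinnertonDyer.Rank1Residual.ManinAdditive

end
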